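import Mathlib
import HarnessLib
import Summits.RiemannHypothesis.RiemannHypothesis.Theorems.WeilGroundStateGroundStateSimpleEvenStubHyperbolicBounds

/-!
# Route `IntegerScrew` — small-argument expansion of Suzuki's `Ψ`: elementary pieces

Elementary two-sided bounds, for `0 < s ≤ 2`, on the three pieces of the closed-form derivative
`Ψ'(s) = 2(e^{s/2} − e^{−s/2}) − κ/2 + artanh(e^{−s/2}) + arctan(e^{−s/2})` of Suzuki's screw function on
`(0, log 2)` (`IntegerScrewPsiDeriv`) after removal of their Taylor heads:

* `hyp_abs_exp_sub_taylor_five_le`, `abs_exp_sub_taylor3_le` — `exp` Taylor remainders on `[−1, 1]` (Mathlib `Real.exp_bound`);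
* the hyperbolic piece: `|2(e^{s/2} − e^{−s/2}) − 2s − s³/12| ≤ s⁵/800` (`abs_hypPiece_sub_le`);
* the logarithmic piece `f₃(s) = artanh(e^{−s/2}) + (log s)/2 − log 2 ∈ [s²/96 − s⁴/3200, s²/96 + s⁴/12800]`
  (`logPiece_bounds`; `f₃' = 1/(2s) − 1/(2(e^{s/2} − e^{−s/2}))`, monotone comparison on `(0, 2]` and the limit
  `f₃ → 0` at `0⁺` from `(1 − e^{−s/2})/s → 1/2`).

The arctangent piece and the assembly are in `IntegerScrewPsiSmallArg`. Used by the kernel certificate of the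
top-block pairing negativity (SCREW column, rh-explicit cell). Nothing here bears on the truth of RH.
References: [folklore] (calculus); M. Suzuki, J. Lond. Math. Soc. (2) 108 (2023), (1.1) [Suzuki2023] for `Ψ`.
-/

set_option linter.dupNamespace false
set_option autoImplicit false

noncomputable section

open scoped Topology BigOperators
open Real Filter Set

namespace Summit.RiemannHypothesis.RiemannHypothesis.Theorems.IntegerScrew

open Summit.RiemannHypothesis.RiemannHypothesis.Theorems.GroundStateSimpleEven (hyp_abs_exp_sub_taylor_five_le)

/-! ## Small-argument expansion of `Ψ`: elementary Taylor pieces -/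

/-- Fourth-order Taylor bound for `exp` on `[-1, 1]`:
`|e^x − (1 + x + x²/2 + x³/6)| ≤ (5/96)|x|⁴`. [folklore] -/
theorem abs_exp_sub_taylor3_le {x : ℝ} (hx : |x| ≤ 1) :
    |Real.exp x - (1 + x + x ^ 2 / 2 + x ^ 3 / 6)| ≤ 5 / 96 * |x| ^ 4 := by
  have h := Real.exp_bound hx (n := 4) (by norm_num)
  have hs : ∑ m ∈ Finset.range 4, x ^ m / (m.factorial : ℝ) = 1 + x + x ^ 2 / 2 + x ^ 3 / 6 := by
    simp [Finset.sum_range_succ, Nat.factorial]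
  rw [hs] at h
  have hc : ((4 : ℕ).succ : ℝ) / ((4 : ℕ).factorial * (4 : ℕ)) = 5 / 96 := by
    norm_num [Nat.factorial]
  rw [hc] at h
  linarith

/-- The hyperbolic piece `f₁(s) = 2(e^{s/2} − e^{−s/2}) − 2s` of `Ψ'` minus its cubic term:
`|f₁(s) − s³/12| ≤ s⁵/800` for `0 ≤ s ≤ 2`. [folklore] -/
theorem abs_hypPiece_sub_le {s : ℝ} (h0 : 0 ≤ s) (h2 : s ≤ 2) :
    |2 * (Real.exp (s / 2) - Real.exp (-(s / 2))) - 2 * s - s ^ 3 / 12| ≤ s ^ 5 / 800 := by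
  have hx : |s / 2| ≤ 1 := by rw [abs_of_nonneg (by linarith)]; linarith
  have hx' : |-(s / 2)| ≤ 1 := by rw [abs_neg]; exact hx
  have e1 := hyp_abs_exp_sub_taylor_five_le hx
  have e2 := hyp_abs_exp_sub_taylor_five_le hx'
  rw [abs_of_nonneg (by linarith : (0:ℝ) ≤ s / 2)] at e1
  rw [abs_neg, abs_of_nonneg (by linarith : (0:ℝ) ≤ s / 2)] at e2
  rw [abs_le] at e1 e2 ⊢
  constructor <;> nlinarith [e1.1, e1.2, e2.1, e2.2]

/-- `e^{x} + e^{−x} − 2 ∈ [0, x² + (5/48)x⁴]` for `|x| ≤ 1`. [folklore] -/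
theorem exp_add_exp_neg_sub_two_bounds {x : ℝ} (hx : |x| ≤ 1) :
    0 ≤ Real.exp x + Real.exp (-x) - 2 ∧ Real.exp x + Real.exp (-x) - 2 ≤ x ^ 2 + 5 / 48 * x ^ 4 := by
  constructor
  · have a1 := Real.add_one_le_exp x
    have a2 := Real.add_one_le_exp (-x)
    linarith
  · have e1 := abs_exp_sub_taylor3_le hx
    have hx' : |-x| ≤ 1 := by rwa [abs_neg]
    have e2 := abs_exp_sub_taylor3_le hx'
    rw [abs_neg] at e2
    rw [abs_le] at e1 e2
    have h4 : |x| ^ 4 = x ^ 4 := by rw [← abs_pow, abs_of_nonneg (by positivity)]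
    rw [h4] at e1 e2
    nlinarith [e1.2, e2.2]


/-! ### The logarithmic piece `f₃(s) = artanh(e^{−s/2}) − ½ log(1/s) − log 2` -/

/-- The `artanh` piece of `Ψ'` with the cusp `½ log(1/s)` and the constant `log 2` removed
(for `s > 0`; `= ½ log((s/4) coth(s/4))`). [folklore] -/
def logPiece (s : ℝ) : ℝ :=
  (Real.log (1 + Real.exp (-(s / 2))) - Real.log (1 - Real.exp (-(s / 2)))) / 2
    + Real.log s / 2 - Real.log 2

/-- Its derivative `1/(2s) − w/(2(1 − w²))`, `w = e^{−s/2}`. [folklore] -/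
def logPieceDeriv (s : ℝ) : ℝ :=
  1 / (2 * s) - Real.exp (-(s / 2)) / (2 * (1 - Real.exp (-(s / 2)) ^ 2))

/-- `e^{−s/2} < 1` for `s > 0`. [folklore] -/
private lemma exp_neg_half_lt_one {s : ℝ} (hs : 0 < s) : Real.exp (-(s / 2)) < 1 := by
  rw [Real.exp_lt_one_iff]; linarith

/-- The derivative of the logarithmic piece (`s > 0`). [folklore] -/
theorem hasDerivAt_logPiece {s : ℝ} (hs : 0 < s) : HasDerivAt logPiece (logPieceDeriv s) s := by
  set w := Real.exp (-(s / 2)) with hw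
  have hw0 : 0 < w := Real.exp_pos _
  have hw1 : w < 1 := exp_neg_half_lt_one hs
  have hwd : HasDerivAt (fun y : ℝ => Real.exp (-(y / 2))) (w * -(1 / 2)) s := by
    have h := ((hasDerivAt_id s).div_const 2).neg.exp
    simp only [id] at h
    exact h
  have h1 : HasDerivAt (fun y : ℝ => Real.log (1 + Real.exp (-(y / 2)))) ((w * -(1 / 2)) / (1 + w)) s := by
    have h := (hwd.const_add 1).log (by rw [← hw]; linarith)
    simpa [hw] using h
  have h2 : HasDerivAt (fun y : ℝ => Real.log (1 - Real.exp (-(y / 2)))) ((-(w * -(1 / 2))) / (1 - w)) s := by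
    have h := ((hasDerivAt_const s (1 : ℝ)).sub hwd).log (by
      simp only [Pi.sub_apply]
      exact (sub_pos.2 (exp_neg_half_lt_one hs)).ne')
    simpa [hw] using h
  have h3 : HasDerivAt (fun y : ℝ => Real.log y / 2) (s⁻¹ / 2) s :=
    (Real.hasDerivAt_log hs.ne').div_const 2
  have h := (((h1.sub h2).div_const 2).add h3).sub_const (Real.log 2)
  have hfun : logPiece = fun y => ((Real.log (1 + Real.exp (-(y / 2))) - Real.log (1 - Real.exp (-(y / 2)))) / 2
      + Real.log y / 2) - Real.log 2 := by
    funext y; simp only [logPiece]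
  rw [hfun]
  refine (h.congr_of_eventuallyEq (Filter.Eventually.of_forall fun y => ?_)).congr_deriv ?_
  · simp only [Pi.add_apply, Pi.sub_apply]
  · unfold logPieceDeriv
    rw [← hw]
    have h1w : (1 : ℝ) + w ≠ 0 := by linarith
    have h2w : (1 : ℝ) - w ≠ 0 := by linarith
    have h3w : (1 : ℝ) - w ^ 2 ≠ 0 := by nlinarith
    field_simp
    ring

/-- Continuity of the logarithmic piece on `(0, ∞)`. [folklore] -/
theorem continuousOn_logPiece : ContinuousOn logPiece (Set.Ioi 0) := fun _ hs =>
  (hasDerivAt_logPiece hs).continuousAt.continuousWithinAt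

/-- Bounds on `e^{s/2} − e^{−s/2}` for `0 ≤ s ≤ 2`. [folklore] -/
theorem exp_sub_exp_neg_bounds {s : ℝ} (h0 : 0 ≤ s) (h2 : s ≤ 2) :
    s + s ^ 3 / 24 - s ^ 5 / 1600 ≤ Real.exp (s / 2) - Real.exp (-(s / 2)) ∧
      Real.exp (s / 2) - Real.exp (-(s / 2)) ≤ s + s ^ 3 / 24 + s ^ 5 / 1600 := by
  have hx : |s / 2| ≤ 1 := by rw [abs_of_nonneg (by linarith)]; linarith
  have hx' : |-(s / 2)| ≤ 1 := by rw [abs_neg]; exact hx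
  have e1 := hyp_abs_exp_sub_taylor_five_le hx
  have e2 := hyp_abs_exp_sub_taylor_five_le hx'
  rw [abs_of_nonneg (by linarith : (0:ℝ) ≤ s / 2)] at e1
  rw [abs_neg, abs_of_nonneg (by linarith : (0:ℝ) ≤ s / 2)] at e2
  rw [abs_le] at e1 e2
  constructor <;> nlinarith [e1.1, e1.2, e2.1, e2.2]

/-- `s/48 − s³/800 ≤ f₃'(s) ≤ s/48 + s³/3200` for `0 < s ≤ 2`. [folklore] -/
theorem logPieceDeriv_bounds {s : ℝ} (h0 : 0 < s) (h2 : s ≤ 2) :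
    s / 48 - s ^ 3 / 800 ≤ logPieceDeriv s ∧ logPieceDeriv s ≤ s / 48 + s ^ 3 / 3200 := by
  set w := Real.exp (-(s / 2)) with hw
  set d := Real.exp (s / 2) - Real.exp (-(s / 2)) with hd
  have hw0 : 0 < w := Real.exp_pos _
  have hprod : Real.exp (s / 2) * w = 1 := by rw [hw, ← Real.exp_add]; simp
  have hdw : d * w = 1 - w ^ 2 := by rw [hd, sub_mul, hprod]; ring
  obtain ⟨hdlo, hdhi⟩ := exp_sub_exp_neg_bounds h0.le h2
  rw [← hd] at hdlo hdhi
  have hs5 : s ^ 5 / 1600 ≤ s ^ 3 / 24 := by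
    have hs2 : s ^ 2 ≤ 4 := by nlinarith
    have h35 : s ^ 5 = s ^ 3 * s ^ 2 := by ring
    rw [div_le_div_iff₀ (by norm_num) (by norm_num), h35]
    nlinarith [pow_pos h0 3, mul_le_mul_of_nonneg_left hs2 (pow_pos h0 3).le]
  have hds : s ≤ d := by linarith
  have hdpos : 0 < d := by linarith
  -- `f₃' = 1/(2s) − 1/(2d)`
  have hD : logPieceDeriv s = 1 / (2 * s) - 1 / (2 * d) := by
    unfold logPieceDeriv
    rw [← hw, ← hdw]
    field_simp
  rw [hD]
  have hkey : 1 / (2 * s) - 1 / (2 * d) = (d - s) / (2 * s * d) := by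
    field_simp
  rw [hkey]
  constructor
  · -- lower bound
    rw [le_div_iff₀ (by positivity)]
    have ha : d ≤ s * (1 + s ^ 2 / 24 + s ^ 4 / 1600) := by nlinarith
    have hnn : 0 ≤ s / 48 - s ^ 3 / 800 := by nlinarith
    calc (s / 48 - s ^ 3 / 800) * (2 * s * d)
        ≤ (s / 48 - s ^ 3 / 800) * (2 * s * (s * (1 + s ^ 2 / 24 + s ^ 4 / 1600))) := by
          apply mul_le_mul_of_nonneg_left _ hnn
          nlinarith
      _ ≤ s + s ^ 3 / 24 - s ^ 5 / 1600 - s := by nlinarith [pow_pos h0 5, pow_pos h0 7, pow_pos h0 9]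
      _ ≤ d - s := by linarith
  · -- upper bound
    rw [div_le_iff₀ (by positivity)]
    calc d - s ≤ s ^ 3 / 24 + s ^ 5 / 1600 := by linarith
      _ = (s / 48 + s ^ 3 / 3200) * (2 * s * s) := by ring
      _ ≤ (s / 48 + s ^ 3 / 3200) * (2 * s * d) := by
          apply mul_le_mul_of_nonneg_left _ (by positivity)
          nlinarith

/-- `f₃(s) → 0` as `s → 0⁺` (`(1 − e^{−s/2})/s → 1/2`). [folklore] -/
theorem tendsto_logPiece_zero : Tendsto logPiece (𝓝[>] 0) (𝓝 0) := by
  -- the slope `(1 − e^{−s/2})/s → 1/2`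
  have hwd : HasDerivAt (fun y : ℝ => Real.exp (-(y / 2))) (Real.exp (-((0:ℝ) / 2)) * -(1 / 2)) 0 := by
    have h := ((hasDerivAt_id (0:ℝ)).div_const 2).neg.exp
    simp only [id] at h
    exact h
  have hd : HasDerivAt (fun y : ℝ => 1 - Real.exp (-(y / 2))) (1 / 2) 0 := by
    have h := (hasDerivAt_const (0:ℝ) (1:ℝ)).sub hwd
    refine h.congr_deriv ?_
    simp
  have hslope := hd.tendsto_slope_zero_right
  have hq : Tendsto (fun s : ℝ => (1 - Real.exp (-(s / 2))) / s) (𝓝[>] 0) (𝓝 (1 / 2)) := by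
    refine hslope.congr' ?_
    filter_upwards [self_mem_nhdsWithin] with s _
    simp only [zero_add, smul_eq_mul]
    simp
    ring
  have hlogq : Tendsto (fun s : ℝ => Real.log ((1 - Real.exp (-(s / 2))) / s)) (𝓝[>] 0)
      (𝓝 (Real.log (1 / 2))) :=
    ((Real.continuousAt_log (by norm_num)).tendsto).comp hq
  have hlog1 : Tendsto (fun s : ℝ => Real.log (1 + Real.exp (-(s / 2)))) (𝓝[>] 0)
      (𝓝 (Real.log 2)) := by
    have hc : ContinuousAt (fun s : ℝ => Real.log (1 + Real.exp (-(s / 2)))) 0 := by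
      have h1 : ContinuousAt (fun s : ℝ => 1 + Real.exp (-(s / 2))) 0 := by fun_prop
      exact (Real.continuousAt_log (by norm_num)).comp' (by simpa using h1)
    have := hc.tendsto
    simp only [neg_zero, zero_div, Real.exp_zero] at this
    norm_num at this
    exact this.mono_left nhdsWithin_le_nhds
  -- `logPiece s = ½ log(1 + w) − ½ log((1 − w)/s) − log 2` for `s > 0`
  have heq : ∀ᶠ s in 𝓝[>] (0:ℝ), logPiece s
      = Real.log (1 + Real.exp (-(s / 2))) / 2 - Real.log ((1 - Real.exp (-(s / 2))) / s) / 2 - Real.log 2 := by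
    filter_upwards [self_mem_nhdsWithin] with s hs
    have hs' : (0:ℝ) < s := hs
    have hw1 : Real.exp (-(s / 2)) < 1 := exp_neg_half_lt_one hs'
    rw [Real.log_div (by linarith) hs'.ne']
    simp only [logPiece]
    ring
  have hlim : Tendsto (fun s : ℝ => Real.log (1 + Real.exp (-(s / 2))) / 2
      - Real.log ((1 - Real.exp (-(s / 2))) / s) / 2 - Real.log 2) (𝓝[>] 0) (𝓝 0) := by
    have := ((hlog1.div_const 2).sub (hlogq.div_const 2)).sub_const (Real.log 2)
    have hval : Real.log 2 / 2 - Real.log (1 / 2) / 2 - Real.log 2 = 0 := by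
      rw [one_div, Real.log_inv]; ring
    rw [hval] at this
    exact this
  exact hlim.congr' (heq.mono fun s hs => hs.symm)

/-- `s²/96 − s⁴/3200 ≤ f₃(s) ≤ s²/96 + s⁴/12800` for `0 < s ≤ 2`. [folklore] -/
theorem logPiece_bounds {s : ℝ} (h0 : 0 < s) (h2 : s ≤ 2) :
    s ^ 2 / 96 - s ^ 4 / 3200 ≤ logPiece s ∧ logPiece s ≤ s ^ 2 / 96 + s ^ 4 / 12800 := by
  have hD : Convex ℝ (Set.Ioc (0 : ℝ) 2) := convex_Ioc 0 2
  have hint : interior (Set.Ioc (0 : ℝ) 2) = Set.Ioo 0 2 := interior_Ioc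
  -- upper: `H(s) = s²/96 + s⁴/12800 − f₃(s)` is monotone on `(0, 2]` and tends to `0` at `0⁺`
  have hHd : ∀ x, 0 < x → HasDerivAt (fun x => x ^ 2 / 96 + x ^ 4 / 12800 - logPiece x)
      (2 * x / 96 + 4 * x ^ 3 / 12800 - logPieceDeriv x) x := by
    intro x hx
    have h1 : HasDerivAt (fun x : ℝ => x ^ 2 / 96) (2 * x / 96) x := by
      have := (hasDerivAt_pow 2 x).div_const 96; simpa using this
    have h2 : HasDerivAt (fun x : ℝ => x ^ 4 / 12800) (4 * x ^ 3 / 12800) x := by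
      have := (hasDerivAt_pow 4 x).div_const 12800; simpa using this
    have h := (h1.add h2).sub (hasDerivAt_logPiece hx)
    exact h.congr_of_eventuallyEq (Filter.Eventually.of_forall fun y => by
      simp only [Pi.add_apply, Pi.sub_apply])
  have hLd : ∀ x, 0 < x → HasDerivAt (fun x => logPiece x - x ^ 2 / 96 + x ^ 4 / 3200)
      (logPieceDeriv x - 2 * x / 96 + 4 * x ^ 3 / 3200) x := by
    intro x hx
    have h1 : HasDerivAt (fun x : ℝ => x ^ 2 / 96) (2 * x / 96) x := by
      have := (hasDerivAt_pow 2 x).div_const 96; simpa using this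
    have h2 : HasDerivAt (fun x : ℝ => x ^ 4 / 3200) (4 * x ^ 3 / 3200) x := by
      have := (hasDerivAt_pow 4 x).div_const 3200; simpa using this
    have h := ((hasDerivAt_logPiece hx).sub h1).add h2
    exact h.congr_of_eventuallyEq (Filter.Eventually.of_forall fun y => by
      simp only [Pi.add_apply, Pi.sub_apply])
  have hmonoH : MonotoneOn (fun x => x ^ 2 / 96 + x ^ 4 / 12800 - logPiece x) (Set.Ioc (0:ℝ) 2) := by
    refine monotoneOn_of_deriv_nonneg hD ?_ ?_ ?_
    · intro x hx; exact (hHd x hx.1).continuousAt.continuousWithinAt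
    · intro x hx; rw [hint] at hx; exact (hHd x hx.1).differentiableAt.differentiableWithinAt
    · intro x hx; rw [hint] at hx
      rw [(hHd x hx.1).deriv]
      have := (logPieceDeriv_bounds hx.1 hx.2.le).2
      nlinarith
  have hmonoL : MonotoneOn (fun x => logPiece x - x ^ 2 / 96 + x ^ 4 / 3200) (Set.Ioc (0:ℝ) 2) := by
    refine monotoneOn_of_deriv_nonneg hD ?_ ?_ ?_
    · intro x hx; exact (hLd x hx.1).continuousAt.continuousWithinAt
    · intro x hx; rw [hint] at hx; exact (hLd x hx.1).differentiableAt.differentiableWithinAt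
    · intro x hx; rw [hint] at hx
      rw [(hLd x hx.1).deriv]
      have := (logPieceDeriv_bounds hx.1 hx.2.le).1
      nlinarith
  -- limits at `0⁺`
  have hpoly1 : Tendsto (fun x : ℝ => x ^ 2 / 96 + x ^ 4 / 12800) (𝓝[>] 0) (𝓝 0) := by
    have : ContinuousAt (fun x : ℝ => x ^ 2 / 96 + x ^ 4 / 12800) 0 := by fun_prop
    have h := this.tendsto; simp at h
    exact h.mono_left nhdsWithin_le_nhds
  have hpoly2 : Tendsto (fun x : ℝ => x ^ 2 / 96 - x ^ 4 / 3200) (𝓝[>] 0) (𝓝 0) := by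
    have : ContinuousAt (fun x : ℝ => x ^ 2 / 96 - x ^ 4 / 3200) 0 := by fun_prop
    have h := this.tendsto; simp at h
    exact h.mono_left nhdsWithin_le_nhds
  have hTH : Tendsto (fun x => x ^ 2 / 96 + x ^ 4 / 12800 - logPiece x) (𝓝[>] 0) (𝓝 0) := by
    have := hpoly1.sub tendsto_logPiece_zero; simpa using this
  have hTL : Tendsto (fun x => logPiece x - x ^ 2 / 96 + x ^ 4 / 3200) (𝓝[>] 0) (𝓝 0) := by
    have := tendsto_logPiece_zero.sub hpoly2
    refine (this.congr fun x => by ring).mono_right ?_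
    simp
  have hev : ∀ᶠ ε in 𝓝[>] (0:ℝ), ε ∈ Set.Ioc (0:ℝ) s := Ioc_mem_nhdsGT h0
  constructor
  · have hle : ∀ᶠ ε in 𝓝[>] (0:ℝ), (fun x => logPiece x - x ^ 2 / 96 + x ^ 4 / 3200) ε
        ≤ (fun x => logPiece x - x ^ 2 / 96 + x ^ 4 / 3200) s := by
      filter_upwards [hev] with ε hε
      exact hmonoL ⟨hε.1, hε.2.trans h2⟩ ⟨h0, h2⟩ hε.2
    have := le_of_tendsto hTL hle
    simp only at this
    linarith
  · have hle : ∀ᶠ ε in 𝓝[>] (0:ℝ), (fun x => x ^ 2 / 96 + x ^ 4 / 12800 - logPiece x) ε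
        ≤ (fun x => x ^ 2 / 96 + x ^ 4 / 12800 - logPiece x) s := by
      filter_upwards [hev] with ε hε
      exact hmonoH ⟨hε.1, hε.2.trans h2⟩ ⟨h0, h2⟩ hε.2
    have := le_of_tendsto hTH hle
    simp only at this
    linarith


end Summit.RiemannHypothesis.RiemannHypothesis.Theorems.IntegerScrew

end
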